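import Summits.AnomalousDissipation.AnomalousDissipation.Theses.VirtualDissipation
import Summits.AnomalousDissipation.AnomalousDissipation.Theorems.EnsembleRigidityGPStatisticalRigidityGpSmallEnergy
import Summits.AnomalousDissipation.AnomalousDissipation.Theorems.EnsembleRigidityGPMeanBoundedFamilyStubHeadCoefficients

/-!
# Negative lemmas for crux `LightSteadyStatesGP` (stmt-AnomalousDissipation-15151, route VirtualDissipation) —
# degenerate-witness exclusions (refuter crux-attack, cycle 1, 2026-08-17)

The crux is purely existential:
`∃ ν_j ∈ (0,1], ν_j → 0, ∃ (u_j, p_j)` classical steady states of `NS_{ν_j}(f_GP)` on the unit torus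
(`Torus.IsClassicalNSSolutionOn univ` on time-constant data, force
`f_GP(x) = sin(2πx₂)e₀ + sin(2πx₀)e₁ + sin(2πx₁)e₂` inline) with `∫ u_j = 0` and `∫ |u_j|² ≤ 2`.
An existential crux is "vacuous" only if junk inhabits it.  This file certifies, sorry-free, that the
obvious explicit candidates do NOT inhabit it, so that any witness is a genuine nonlinear–viscous balance:

* `gp_ne_gradient` — `f_GP` is not the gradient of a smooth periodic scalar
  (`∫⟪∇p, f_GP⟫ = 0` by solenoidality versus `∫ |f_GP|² = 3/2`);
* `zero_not_steadyStateGP` — the rest state `u = 0` (energy `0 ≤ 2`, mean zero) is a classical steady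
  state of `NS_ν(f_GP)` for NO `ν` and NO pressure: the momentum equation would read `∇p = f_GP`;
* `witness_slice_ne_zero` — so every slice `u_j` of every witness of the crux is a non-zero field
  (stated against the literal steady-state conjunct of the route decl);
* `laplacian_gpForce` — `Δ f_GP = −4π² f_GP` (first shell);
* `integral_inner_gpForce_lambMode` — `∫⟪f_GP, g⟫ = 0` for the Lamb mode `g = (f_GP·∇)f_GP/(2π)`;
* `laminar_not_steadyStateGP` — the LAMINAR (Kolmogorov-type) ansatz `u = c • f_GP` is a classical
  steady state of `NS_ν(f_GP)` for NO `c, ν, p`: testing the momentum equation against `g` gives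
  `c²·2π·(3/4) = 0`, i.e. `c = 0`, excluded above.  Unlike a single Stokes eigenmode force (exact laminar
  state `f/(4π²ν)`, energy `∝ ν⁻²`), `f_GP` has a non-gradient Lamb vector, so the crux has neither the
  explicit one-mode witness nor the explicit one-mode obstruction; its witnesses (if any) live on genuinely
  nonlinear branches (numerics: primary cyclic⊕odd branch, `E_unit ≈ 0.86–1.02` for `ν_box ∈ [0.0144, 1]`,
  item evidence NumericsJ018975.md).

Interface non-junk: `IsClassicalNSSolutionOn` REQUIRES joint smoothness of `u` and `p`, so the operators
`Torus.gradient/laplacian/convect` (`fderiv`-of-lift wrappers, junk `0` off the smooth class) are never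
evaluated at junk, and the Bochner integrals `∫ u`, `∫ |u|²` are genuine for smooth `u` on the compact torus;
genuine inhabitants for every fixed `ν > 0` exist in the tree (`Torus.Temam1979_exists_steadyWeakSolution_holds`
+ `…_smooth_holds` + `Theorems…CensusInterior.exists_isSteadyNSState`).  Tools reused: landed
`stub_gpAdmissible`, `gpForce_integral_inner_self`, `stub_lambIdentity`, `stub_headModes`,
`StubHeadCoefficients.{gpForce_eq_sum, lambMode_eq_sum, integral_inner_sum_sinMode, integral_norm_sq_lambMode}`,
`Torus.laplacian_finset_sum_smul`, `Torus.laplacian_stokesMode`, `Torus.integral_inner_gradient_eq_zero_of_isDivFree`.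
-/

set_option linter.dupNamespace false

noncomputable section

open MeasureTheory Set
open scoped InnerProductSpace RealInnerProductSpace

namespace Summit.AnomalousDissipation.AnomalousDissipation.Theorems.LightSteadyStatesGP.Negative.TrivialWitnesses

open Literature.Analysis.FunctionSpaces Literature.Analysis.FluidPDE
open Summit.AnomalousDissipation.AnomalousDissipation.Theorems.EnsembleRigidity
open Summit.AnomalousDissipation.AnomalousDissipation.Theorems.EnsembleRigidity.GPStatisticalRigidity
open Summit.AnomalousDissipation.AnomalousDissipation.Theorems.EnsembleRigidity.GPMeanBoundedFamily

/-- `f_GP` is not the gradient of a smooth scalar on `T³`. [folklore] -/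
theorem gp_ne_gradient {p : UnitAddTorus (Fin 3) → ℝ} (hp : Torus.IsSmooth p) :
    ¬ ∀ x, Torus.gradient p x = gpForce x := by
  intro h
  obtain ⟨hfs, hfd, -⟩ :=
    Summit.AnomalousDissipation.AnomalousDissipation.Theorems.SteadyStatesLoudBounded.GpAdmissible.stub_gpAdmissible
  have h0 : ∫ x, ⟪Torus.gradient p x, gpForce x⟫_ℝ = 0 :=
    Torus.integral_inner_gradient_eq_zero_of_isDivFree hfs hp hfd
  simp_rw [h] at h0
  rw [gpForce_integral_inner_self] at h0
  norm_num at h0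

/-- The rest state is not a classical steady state of `NS_ν(f_GP)`, whatever `ν` and `p`. [folklore] -/
theorem zero_not_steadyStateGP (ν : ℝ) (p : UnitAddTorus (Fin 3) → ℝ) :
    ¬ Torus.IsClassicalNSSolutionOn Set.univ ν (fun _ => gpForce)
        (fun _ => fun _ : UnitAddTorus (Fin 3) => (0 : EuclideanSpace ℝ (Fin 3))) (fun _ => p) := by
  intro h
  have hp : Torus.IsSmooth p := h.smooth_pressure.isSmooth_slice (Set.mem_univ (0 : ℝ))
  refine gp_ne_gradient hp fun x => ?_
  have hm := h.momentum 0 (Set.mem_univ _) x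
  have h0 : Torus.timeDerivWithin Set.univ
      (fun _ : ℝ => fun _ : UnitAddTorus (Fin 3) => (0 : EuclideanSpace ℝ (Fin 3))) 0 x = 0 := by
    simp [Torus.timeDerivWithin]
  have hc : Torus.convect (fun _ : UnitAddTorus (Fin 3) => (0 : EuclideanSpace ℝ (Fin 3)))
      (fun _ : UnitAddTorus (Fin 3) => (0 : EuclideanSpace ℝ (Fin 3))) x = 0 := by
    simp [Torus.convect]
  have hl : Torus.laplacian (fun _ : UnitAddTorus (Fin 3) => (0 : EuclideanSpace ℝ (Fin 3))) x = 0 := by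
    unfold Torus.laplacian Torus.liftAt
    simp
  rw [h0, hc, hl, smul_zero, zero_sub, add_zero] at hm
  exact neg_add_eq_zero.mp hm.symm

/-- The force of the crux, written inline exactly as in the route file, IS `gpForce` (`rfl`). -/
example : (fun x : UnitAddTorus (Fin 3) => (Literature.Analysis.FluidPDE.Torus.stokesMode (Pi.single (2 : Fin 3) (1 : ℤ)) (EuclideanSpace.single (0 : Fin 3) (1 : ℝ)) false x + Literature.Analysis.FluidPDE.Torus.stokesMode (Pi.single (0 : Fin 3) (1 : ℤ)) (EuclideanSpace.single (1 : Fin 3) (1 : ℝ)) false x + Literature.Analysis.FluidPDE.Torus.stokesMode (Pi.single (1 : Fin 3) (1 : ℤ)) (EuclideanSpace.single (2 : Fin 3) (1 : ℝ)) false x : EuclideanSpace ℝ (Fin 3))) = gpForce := rfl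

/-- **Every slice of every witness of the crux is a non-zero field.**  Stated against the literal
steady-state conjunct of `LightSteadyStatesGP` (force inline, time-constant data). [folklore] -/
theorem witness_slice_ne_zero {ν : ℝ} {u : UnitAddTorus (Fin 3) → EuclideanSpace ℝ (Fin 3)}
    {p : UnitAddTorus (Fin 3) → ℝ}
    (h : Torus.IsClassicalNSSolutionOn Set.univ ν (fun _ => fun x : UnitAddTorus (Fin 3) => (Literature.Analysis.FluidPDE.Torus.stokesMode (Pi.single (2 : Fin 3) (1 : ℤ)) (EuclideanSpace.single (0 : Fin 3) (1 : ℝ)) false x + Literature.Analysis.FluidPDE.Torus.stokesMode (Pi.single (0 : Fin 3) (1 : ℤ)) (EuclideanSpace.single (1 : Fin 3) (1 : ℝ)) false x + Literature.Analysis.FluidPDE.Torus.stokesMode (Pi.single (1 : Fin 3) (1 : ℤ)) (EuclideanSpace.single (2 : Fin 3) (1 : ℝ)) false x : EuclideanSpace ℝ (Fin 3))) (fun _ => u) (fun _ => p)) :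
    u ≠ 0 := by
  rintro rfl
  exact zero_not_steadyStateGP ν p h

/-- `Δ f_GP = −4π² f_GP`: the three modes of `f_GP` sit on the first shell `|k| = 1`. [folklore] -/
theorem laplacian_gpForce (x : UnitAddTorus (Fin 3)) :
    Torus.laplacian gpForce x = (-(4 * Real.pi ^ 2)) • gpForce x := by
  have h : Torus.laplacian (fun y : UnitAddTorus (Fin 3) => ∑ i : Fin 3, (1 : ℝ) •
      (Torus.stokesMode (![![0, 0, 1], ![1, 0, 0], ![0, 1, 0]] i) (EuclideanSpace.single i (1 : ℝ)) false y :
        EuclideanSpace ℝ (Fin 3))) x =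
      ∑ i : Fin 3, (1 : ℝ) • Torus.laplacian
        (⇑(Torus.stokesMode (![![0, 0, 1], ![1, 0, 0], ![0, 1, 0]] i) (EuclideanSpace.single i (1 : ℝ)) false)) x :=
    Literature.Analysis.FluidPDE.Torus.laplacian_finset_sum_smul Finset.univ (fun _ => (1 : ℝ))
      (fun i => Torus.isSmooth_stokesMode _ _ _) x
  rw [StubHeadCoefficients.gpForce_eq_sum, h]
  simp only [Torus.laplacian_stokesMode, one_smul, Finset.smul_sum, smul_smul]
  refine Finset.sum_congr rfl fun i _ => ?_
  congr 1
  fin_cases i <;> simp [Torus.stokesEigenvalue, Torus.freqNormSq, Fin.sum_univ_three]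

/-- `∫⟪f_GP, g⟫ = 0` for the Lamb mode `g` (first shell against second shell). [folklore] -/
theorem integral_inner_gpForce_lambMode :
    ∫ x : UnitAddTorus (Fin 3), ⟪gpForce x, lambMode x⟫_ℝ = 0 := by
  simp only [StubHeadCoefficients.gpForce_eq_sum, StubHeadCoefficients.lambMode_eq_sum]
  rw [StubHeadCoefficients.integral_inner_sum_sinMode]
  simp [Fin.sum_univ_six, Fin.sum_univ_three, EuclideanSpace.inner_single_left]

/-- **The laminar (Kolmogorov-type) ansatz fails for `f_GP`**: no multiple `c • f_GP` of the force is a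
classical steady state of `NS_ν(f_GP)`, for any `c`, `ν`, `p` — unlike a single Stokes eigenmode
(`u = f/(4π²ν)`), the Galloway–Proctor force has the non-gradient Lamb vector `(f·∇)f = 2π g`,
`∫⟪(f·∇)f, g⟫ = 3π/2 ≠ 0`.  So the crux has no explicit one-mode witness (and no explicit one-mode
obstruction either). [folklore] -/
theorem laminar_not_steadyStateGP (c ν : ℝ) (p : UnitAddTorus (Fin 3) → ℝ) :
    ¬ Torus.IsClassicalNSSolutionOn Set.univ ν (fun _ => gpForce)
        (fun _ => fun y : UnitAddTorus (Fin 3) => c • gpForce y) (fun _ => p) := by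
  intro h
  obtain ⟨hfs, hfd, -⟩ : Torus.IsSmooth gpForce ∧ Torus.IsDivFree gpForce ∧ Torus.HasZeroMean gpForce :=
    Summit.AnomalousDissipation.AnomalousDissipation.Theorems.SteadyStatesLoudBounded.GpAdmissible.stub_gpAdmissible
  obtain ⟨⟨hgs, hgd, -⟩, -, -⟩ := stub_headModes
  have hp : Torus.IsSmooth p := h.smooth_pressure.isSmooth_slice (Set.mem_univ (0 : ℝ))
  have hf1 : Torus.IsContDiff 1 gpForce := hfs.isContDiff (by simp)
  -- the momentum equation, pointwise: `c²·2π g = −4π²νc f − ∇p + f`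
  have hm : ∀ x, (c * c * (2 * Real.pi)) • lambMode x =
      (ν * (c * -(4 * Real.pi ^ 2)) + 1) • gpForce x - Torus.gradient p x := by
    intro x
    have h1 := h.momentum 0 (Set.mem_univ _) x
    have ht : Torus.timeDerivWithin Set.univ
        (fun _ : ℝ => fun y : UnitAddTorus (Fin 3) => c • gpForce y) 0 x = 0 := by
      simp [Torus.timeDerivWithin]
    have hc : Torus.convect (fun y : UnitAddTorus (Fin 3) => c • gpForce y)
        (fun y : UnitAddTorus (Fin 3) => c • gpForce y) x = (c * c * (2 * Real.pi)) • lambMode x := by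
      simp only [Torus.convect, map_smul]
      rw [show (fun y : UnitAddTorus (Fin 3) => c • gpForce y) = c • gpForce from rfl,
        Torus.fderiv_const_smul hf1 c x, FunLike.coe_smul, Pi.smul_apply]
      change c • c • Torus.convect gpForce gpForce x = _
      rw [stub_lambIdentity x, smul_smul, smul_smul]
    have hl : Torus.laplacian (fun y : UnitAddTorus (Fin 3) => c • gpForce y) x =
        (c * -(4 * Real.pi ^ 2)) • gpForce x := by
      rw [Torus.laplacian, show Torus.liftAt (fun y : UnitAddTorus (Fin 3) => c • gpForce y) x =
          c • Torus.liftAt gpForce x from rfl,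
        InnerProductSpace.laplacian_smul c
          (((hfs.isContDiff (n := 2) (WithTop.coe_le_coe.mpr le_top)).liftAt x).contDiffAt),
        ← Torus.laplacian, laplacian_gpForce x, smul_smul]
    rw [ht, hc, hl, zero_add, smul_smul] at h1
    rw [h1, add_smul, one_smul]
    abel
  -- test against the Lamb mode `g`: left side `c²·2π·(3/4)`, right side `0`
  have hL : ∫ x : UnitAddTorus (Fin 3), ⟪(c * c * (2 * Real.pi)) • lambMode x, lambMode x⟫_ℝ =
      c * c * (2 * Real.pi) * (3 / 4) := by
    simp_rw [real_inner_smul_left, real_inner_self_eq_norm_sq]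
    rw [integral_const_mul, StubHeadCoefficients.integral_norm_sq_lambMode]
  have iF : Integrable (fun x : UnitAddTorus (Fin 3) => ⟪gpForce x, lambMode x⟫_ℝ) volume :=
    (hfs.inner hgs).integrable
  have iP : Integrable (fun x : UnitAddTorus (Fin 3) => ⟪Torus.gradient p x, lambMode x⟫_ℝ) volume :=
    (hp.gradient.inner hgs).integrable
  have hR : ∫ x : UnitAddTorus (Fin 3),
      ⟪(ν * (c * -(4 * Real.pi ^ 2)) + 1) • gpForce x - Torus.gradient p x, lambMode x⟫_ℝ = 0 := by
    simp_rw [inner_sub_left, real_inner_smul_left]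
    rw [integral_sub (iF.const_mul _) iP, integral_const_mul, integral_inner_gpForce_lambMode,
      Torus.integral_inner_gradient_eq_zero_of_isDivFree hgs hp hgd]
    ring
  simp_rw [hm] at hL
  rw [hR] at hL
  have hc0 : c * c * (2 * Real.pi) * (3 / 4) = 0 := hL.symm
  have : c = 0 := by
    rcases mul_eq_zero.mp hc0 with h' | h'
    · rcases mul_eq_zero.mp h' with h'' | h''
      · exact mul_self_eq_zero.mp h''
      · exfalso; linarith [Real.pi_pos]
    · exfalso; linarith
  subst this
  simp only [zero_smul] at h
  exact zero_not_steadyStateGP ν p h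

end Summit.AnomalousDissipation.AnomalousDissipation.Theorems.LightSteadyStatesGP.Negative.TrivialWitnesses

end
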